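import Mathlib
import HarnessLib
import Literature.MathematicalPhysics.QuantumLattice.HubbardGridCounterQuadratic
import Summits.HubbardSuperconductivity.HubbardSuperconductivity.Theorems.KLProgrammeKLRegimeTorusL1SecondDifferencesSpace
import Summits.HubbardSuperconductivity.HubbardSuperconductivity.Theorems.KLProgrammeKLRegimeSliceSymbolTorus
import Summits.HubbardSuperconductivity.HubbardSuperconductivity.Theorems.KLProgrammeH10TwoPointLimitSymbolProductSampled

/-!
# Route `KLProgramme` — engine support: the INTRINSIC positional `L¹` size of the counterterm quadratic vertex,
# `κ_K(L) = Σ_z ‖Ǩ_L(z)‖ ≤ 256·√(24π²·A·D + 64·A²)` from `|K| ≤ A` and `‖D²K‖ ≤ D` — uniformly in `L`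

Cell `gate-hubbard-kl`, seat hubbard-kl-k3c2-p3; gen-4 ENGINE child stmt-HubbardSuperconductivity-19855 (`stub_engine_scale0`, k3c2-p1 g2's
01:16:00Z (O-θ) plan (b): «Σ_z‖Ǩ_L(z)‖ ≤ C_w·(sup|K| + sup‖D²K‖)»).  `framePosKernel L K z = L⁻² Σ_q K(p_q) conj χ_q(z)`
(`HubbardGridCounterQuadratic`); the tree had only the presentation-dependent `Σ_z‖Ǩ_L(z)‖ ≤ coeffNorm 0 K`.  Here, by the space-only `ℓ²`
route (`sum_norm_charSum_space_le_of_second_differences`) with `G(q) = L⁻²K(p_q)`, `A₀ = A/L²`, all `L²` momenta allowed in the support, and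
the rate `s = (2/π)√(A/D)` matching `‖Δ²_{e_i}G‖ ≤ L⁻²·D·(2π/L)²`:

* `norm_framePosKernel_eq_norm_charSum` — `‖Ǩ_L(z)‖ = ‖Σ_q χ_q(z) • G(q)‖`;
* `frameShift_centred_add_natMul_single` — transport of the frame function along lattice steps (periodicity);
* `norm_fwdDiff_two_frameG_le` — `‖Δ²_{e_i} G(q)‖ ≤ L⁻²·D·(2π/L)²`;
* **`sum_norm_framePosKernel_le_of_bounds`** — `Σ_z ‖Ǩ_L(z)‖ ≤ 256·√(24π²AD + 64A²)` for `0 < A`, `0 < D`,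
  `|frameShift K| ≤ A`, `‖iteratedFDeriv ℝ 2 (frameShift K)‖ ≤ D` (`frameShift K = −K ∘ ofLp` on `EuclideanSpace ℝ (Fin 2)`).

Everything is proved; no definitions, no named facts. [folklore]

References: G. Benfatto, A. Giuliani, V. Mastropietro, Ann. Henri Poincaré 4 (2003) 137–193, §1.2 (2.10); ibid. 7 (2006) 809–898, §2.8 fn. ¹.
-/

noncomputable section

namespace Summit.HubbardSuperconductivity.HubbardSuperconductivity.Theorems.TorusFourierL2

set_option linter.dupNamespace false -- summit = problem name (single-conjunct summit), D-0017

open Finset Complex Literature.MathematicalPhysics.QuantumLattice Literature.Probability.LatticeModels Literature.Analysis.Calculus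
open Summit.HubbardSuperconductivity.HubbardSuperconductivity.Theorems.DispersionFlow
open Summit.HubbardSuperconductivity.HubbardSuperconductivity.Theorems.PerturbedFermiCurve
open scoped Real ComplexConjugate

section PosKernel

variable {L : ℕ}

/-- The axis direction on the torus as the reduction of the integer vector `Pi.single i 1`. [folklore] -/
theorem single_zmod_eq_intCast_single (i : Fin 2) :
    (Pi.single i (1 : ZMod L) : TorusSite 2 L) = fun j => (((Pi.single i (1 : ℤ) : Fin 2 → ℤ) j : ℤ) : ZMod L) := by
  funext j
  by_cases h : j = i
  · subst h; simp
  · simp [h]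

/-- `e_i` has unit length: `(e_i)₀² + (e_i)₁² = 1`. [folklore] -/
theorem sq_add_sq_single (i : Fin 2) :
    (((Pi.single i (1 : ℤ) : Fin 2 → ℤ) 0 : ℤ) : ℝ) ^ 2 + (((Pi.single i (1 : ℤ) : Fin 2 → ℤ) 1 : ℤ) : ℝ) ^ 2 = 1 := by
  fin_cases i <;> simp

variable [NeZero L]

/-- **`‖Ǩ_L(z)‖` as the norm of a character sum** with the real symbol `G(q) = L⁻²K(p_q)`. [folklore] -/
theorem norm_framePosKernel_eq_norm_charSum (K : TrigPolyC4v) (z : TorusSite 2 L) :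
    ‖framePosKernel L K z‖ =
      ‖∑ q : TorusSite 2 L, torusChar q z • (((1 / (L : ℝ) ^ 2 * K.eval (latticeMomentum L q) : ℝ)) : ℂ)‖ := by
  have h : framePosKernel L K z =
      conj (∑ q : TorusSite 2 L, torusChar q z • (((1 / (L : ℝ) ^ 2 * K.eval (latticeMomentum L q) : ℝ)) : ℂ)) := by
    unfold framePosKernel
    rw [map_sum, mul_sum]
    refine sum_congr rfl fun q _ => ?_
    rw [smul_eq_mul, map_mul, Complex.conj_ofReal]
    push_cast
    ring
  rw [h, Complex.norm_conj]

/-- **Transport of the frame function along lattice steps**: for `r : Fin 2 → ℤ` and `j : ℕ`,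
`frameShift K (toLp (p(q + j•r̄))) = frameShift K (toLp (c(q)) + j • toLp((2π/L)·r))`. [folklore] -/
theorem frameShift_lattice_add_natMul_intCast (K : TrigPolyC4v) (q : TorusSite 2 L) (r : Fin 2 → ℤ) (j : ℕ) :
    frameShift K (WithLp.toLp 2 (latticeMomentum L (q + j • fun i => ((r i : ℤ) : ZMod L)))) =
      frameShift K (WithLp.toLp 2 (torusCentredMomentum L q) + (j : ℝ) • WithLp.toLp 2 (fun i => 2 * π / L * (r i : ℝ))) := by
  have hsmul : (j • fun i => ((r i : ℤ) : ZMod L)) = fun i => (((j * r i : ℤ) : ℤ) : ZMod L) := by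
    funext i; simp [nsmul_eq_mul]
  rw [hsmul]
  -- replace the lattice momentum of the translate by its centred representative
  obtain ⟨m₁, hm₁⟩ := exists_torusCentredMomentum_eq_add L (q + fun i => (((j * r i : ℤ) : ℤ) : ZMod L))
  have e1 : frameShift K (WithLp.toLp 2 (latticeMomentum L (q + fun i => (((j * r i : ℤ) : ℤ) : ZMod L)))) =
      frameShift K (WithLp.toLp 2 (torusCentredMomentum L (q + fun i => (((j * r i : ℤ) : ℤ) : ZMod L)))) := by
    rw [hm₁, frameShift_toLp_periodic]
  rw [e1]
  obtain ⟨m, hm⟩ := torusCentredMomentum_add_intCast q (fun i => (j : ℤ) * r i)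
  rw [hm, frameShift_toLp_periodic]
  congr 1
  rw [← WithLp.toLp_smul, ← WithLp.toLp_add]
  congr 1
  funext i
  simp only [Pi.add_apply, Pi.smul_apply, smul_eq_mul]
  push_cast
  ring

/-- **Second lattice differences of `G(q) = L⁻²K(p_q)` along an axis**: `‖Δ²_{e_i} G(q)‖ ≤ L⁻²·D·(2π/L)²` from `‖D²(frameShift K)‖ ≤ D`.
[folklore] -/
theorem norm_fwdDiff_two_frameG_le (K : TrigPolyC4v) {D : ℝ} (hD : ∀ x, ‖iteratedFDeriv ℝ 2 (frameShift K) x‖ ≤ D)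
    (q : TorusSite 2 L) (i : Fin 2) :
    ‖(fwdDiff (Pi.single i (1 : ZMod L) : TorusSite 2 L))^[2]
        (fun q : TorusSite 2 L => (((1 / (L : ℝ) ^ 2 * K.eval (latticeMomentum L q) : ℝ)) : ℂ)) q‖ ≤
      1 / (L : ℝ) ^ 2 * D * (2 * π / L) ^ 2 := by
  have hL : (0 : ℝ) < L := Nat.cast_pos.2 (Nat.pos_of_ne_zero (NeZero.ne L))
  have hD0 : 0 ≤ D := le_trans (norm_nonneg _) (hD 0)
  -- the direction as the reduction of an integer vector, and the continuum step
  have hr2 := sq_add_sq_single i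
  set r : Fin 2 → ℤ := Pi.single i 1 with hr
  have hsingle : (Pi.single i (1 : ZMod L) : TorusSite 2 L) = fun j => ((r j : ℤ) : ZMod L) := by
    rw [hr]; exact single_zmod_eq_intCast_single i
  set Q : EuclideanSpace ℝ (Fin 2) := WithLp.toLp 2 (torusCentredMomentum L q) with hQ
  set w : EuclideanSpace ℝ (Fin 2) := WithLp.toLp 2 (fun j => 2 * π / L * (r j : ℝ)) with hw
  -- the continuum function whose samples along the line are the shifted values
  set gV : EuclideanSpace ℝ (Fin 2) → ℂ := fun x => (((-(1 / (L : ℝ) ^ 2) * frameShift K x : ℝ)) : ℂ) with hgV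
  have hsample : ∀ k : ℕ, (((1 / (L : ℝ) ^ 2 * K.eval (latticeMomentum L (q + k • (Pi.single i (1 : ZMod L) : TorusSite 2 L))) : ℝ)) : ℂ) =
      gV (Q + (k : ℝ) • w) := by
    intro k
    rw [hsingle, hgV]
    simp only
    rw [← frameShift_lattice_add_natMul_intCast K q r k, frameShift_toLp]
    push_cast; ring
  -- both second differences expand into the same three-point sum
  have hexp : ((fwdDiff (Pi.single i (1 : ZMod L) : TorusSite 2 L))^[2]
      (fun q : TorusSite 2 L => (((1 / (L : ℝ) ^ 2 * K.eval (latticeMomentum L q) : ℝ)) : ℂ))) q = ((fwdDiff w)^[2] gV) Q := by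
    rw [fwdDiff_iter_eq_sum_shift, fwdDiff_iter_eq_sum_shift]
    refine sum_congr rfl fun k _ => ?_
    rw [hsample k, Nat.cast_smul_eq_nsmul ℝ]
  rw [hexp]
  -- line-derivative bound
  have hC : ContDiff ℝ 2 (frameShift K) := contDiff_frameShift K
  have hreal : ContDiff ℝ 2 fun s : ℝ => -(1 / (L : ℝ) ^ 2) * frameShift K (Q + s • w) :=
    contDiff_const.mul (contDiff_two_line hC Q w)
  have hφ : ContDiff ℝ 2 fun s : ℝ => gV (Q + s • w) := by
    have : (fun s : ℝ => gV (Q + s • w)) = fun s => (((-(1 / (L : ℝ) ^ 2) * frameShift K (Q + s • w) : ℝ)) : ℂ) := rfl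
    rw [this]; exact Complex.ofRealCLM.contDiff.comp hreal
  have hw_norm : ‖w‖ = 2 * π / L := by
    have hsum : ∑ j, ‖w j‖ ^ 2 = (2 * π / L) ^ 2 := by
      rw [Fin.sum_univ_two, hw]
      simp only [Real.norm_eq_abs, sq_abs]
      have : (2 * π / L * (r 0 : ℝ)) ^ 2 + (2 * π / L * (r 1 : ℝ)) ^ 2 = (2 * π / L) ^ 2 * (((r 0 : ℤ) : ℝ) ^ 2 + ((r 1 : ℤ) : ℝ) ^ 2) := by
        ring
      rw [this, hr, hr2, mul_one]
    rw [EuclideanSpace.norm_eq, hsum, Real.sqrt_sq (by positivity)]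
  refine norm_fwdDiff_iter_apply_le_of_line Q w 2 gV hφ fun s _ => ?_
  have e1 : (fun s : ℝ => gV (Q + s • w)) = fun s => (((-(1 / (L : ℝ) ^ 2) * frameShift K (Q + s • w) : ℝ)) : ℂ) := rfl
  rw [e1, norm_iteratedDeriv_ofReal_comp hreal, iteratedDeriv_const_mul _ ((contDiff_two_line hC Q w).contDiffAt), abs_mul, abs_neg,
    abs_of_pos (by positivity : (0:ℝ) < 1 / (L : ℝ) ^ 2)]
  have h2 := abs_iteratedDeriv_two_line_le hC hD Q w s
  rw [hw_norm] at h2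
  calc 1 / (L : ℝ) ^ 2 * |iteratedDeriv 2 (fun s => frameShift K (Q + s • w)) s| ≤ 1 / (L : ℝ) ^ 2 * (D * (2 * π / L) ^ 2) :=
        mul_le_mul_of_nonneg_left h2 (by positivity)
    _ = _ := by ring

/-- **The intrinsic `L¹` size of the counterterm quadratic vertex**: if `|frameShift K| ≤ A` and `‖D²(frameShift K)‖ ≤ D` with `A, D > 0`,
then `Σ_z ‖Ǩ_L(z)‖ ≤ 256·√(24π²·A·D + 64·A²)`, for every `L`. [cite: BenfattoGiulianiMastropietro2003, §1.2 (2.10)] -/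
theorem sum_norm_framePosKernel_le_of_bounds (K : TrigPolyC4v) {A D : ℝ} (hA : 0 < A) (hD : 0 < D)
    (h0 : ∀ x, |frameShift K x| ≤ A) (h2 : ∀ x, ‖iteratedFDeriv ℝ 2 (frameShift K) x‖ ≤ D) :
    ∑ z : TorusSite 2 L, ‖framePosKernel L K z‖ ≤ 256 * Real.sqrt (24 * π ^ 2 * A * D + 64 * A ^ 2) := by
  classical
  have hL : (0 : ℝ) < L := Nat.cast_pos.2 (Nat.pos_of_ne_zero (NeZero.ne L))
  set G : TorusSite 2 L → ℂ := fun q => (((1 / (L : ℝ) ^ 2 * K.eval (latticeMomentum L q) : ℝ)) : ℂ) with hG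
  -- the rate and the data of the space-only master lemma
  set s : ℝ := 2 / π * Real.sqrt (A / D) with hs
  have hAD : 0 < A / D := div_pos hA hD
  have hs0 : 0 < s := by rw [hs]; positivity
  set R₀ : ℕ := (L - 1) / 2 with hR₀
  have hR₀L : 2 * (R₀ : ℤ) < L := by
    have h1 : 2 * ((L - 1) / 2) ≤ L - 1 := Nat.mul_div_le (L - 1) 2
    have hLpos : 1 ≤ L := Nat.pos_of_ne_zero (NeZero.ne L)
    omega
  have hA₀ : 0 ≤ A / (L : ℝ) ^ 2 := by positivity
  have hsupp : (univ.filter fun k => G k ≠ 0).card ≤ L ^ 2 := by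
    refine (card_filter_le _ _).trans ?_
    rw [card_univ, Fintype.card_pi, Finset.prod_const, ZMod.card, Finset.card_univ, Fintype.card_fin]
  have hsup : ∀ k, ‖G k‖ ≤ A / (L : ℝ) ^ 2 := by
    intro k
    rw [hG]; dsimp only
    rw [Complex.norm_real, Real.norm_eq_abs, abs_mul, abs_of_pos (by positivity : (0:ℝ) < 1 / (L : ℝ) ^ 2)]
    have hk : |K.eval (latticeMomentum L k)| ≤ A := by
      have := h0 (WithLp.toLp 2 (latticeMomentum L k))
      rwa [frameShift_toLp, abs_neg] at this
    calc 1 / (L : ℝ) ^ 2 * |K.eval (latticeMomentum L k)| ≤ 1 / (L : ℝ) ^ 2 * A := mul_le_mul_of_nonneg_left hk (by positivity)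
      _ = A / (L : ℝ) ^ 2 := by ring
  have hrate : 1 / (L : ℝ) ^ 2 * D * (2 * π / L) ^ 2 = A / (L : ℝ) ^ 2 * (4 / (s * L)) ^ 2 := by
    have hsq : s ^ 2 = 4 / π ^ 2 * (A / D) := by
      rw [hs, mul_pow, Real.sq_sqrt hAD.le]; ring
    have hπ : (0 : ℝ) < π := Real.pi_pos
    field_simp
    rw [hsq]
    field_simp
    ring
  have h₁ : ∀ k (i : Fin 2), ‖(fwdDiff (Pi.single i (1 : ZMod L) : TorusSite 2 L))^[2] G k‖ ≤ A / (L : ℝ) ^ 2 * (4 / (s * L)) ^ 2 := by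
    intro k i; rw [← hrate]; exact norm_fwdDiff_two_frameG_le K h2 k i
  have hmain := sum_norm_charSum_space_le_of_second_differences G hs0 hR₀L hA₀ hsupp hsup h₁
  -- the left-hand side
  have hLHS : ∑ z : TorusSite 2 L, ‖framePosKernel L K z‖ = ∑ z : TorusSite 2 L, ‖∑ k : TorusSite 2 L, torusChar k z • G k‖ :=
    sum_congr rfl fun z _ => norm_framePosKernel_eq_norm_charSum K z
  rw [hLHS]
  refine hmain.trans ?_
  -- arithmetic: `√(4096 B)·√(16 L² L²)·(A/L²) = 256 A √B` and `A² B ≤ 24π²AD + 64A²`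
  have hcast : ((L ^ 2 : ℕ) : ℝ) = (L : ℝ) ^ 2 := by push_cast; ring
  rw [hcast]
  have h16 : Real.sqrt (16 * (L : ℝ) ^ 2 * (L : ℝ) ^ 2) = 4 * (L : ℝ) ^ 2 := by
    rw [show (16 : ℝ) * (L : ℝ) ^ 2 * (L : ℝ) ^ 2 = (4 * (L : ℝ) ^ 2) ^ 2 by ring, Real.sqrt_sq (by positivity)]
  rw [h16]
  set B : ℝ := 4 * (2 * Real.sqrt 2 / s + 2) ^ 2 + 16 * (1 / s + 1) ^ 2 / (1 + s * R₀) with hB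
  have hB0 : 0 ≤ B := by positivity
  -- `t = 1/s` with `t² = π² D/(4A)`
  have ht2 : (1 / s) ^ 2 = π ^ 2 * D / (4 * A) := by
    rw [hs]
    have hπ : (0 : ℝ) < π := Real.pi_pos
    have hsq : Real.sqrt (A / D) ^ 2 = A / D := Real.sq_sqrt hAD.le
    have hsq0 : 0 < Real.sqrt (A / D) := Real.sqrt_pos.2 hAD
    rw [one_div, inv_pow, mul_pow, hsq]
    field_simp
    ring
  have ht0 : 0 ≤ 1 / s := by positivity
  have hBle : B ≤ 96 * (1 / s) ^ 2 + 64 := by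
    have h1 : 16 * (1 / s + 1) ^ 2 / (1 + s * R₀) ≤ 16 * (1 / s + 1) ^ 2 := by
      refine div_le_self (by positivity) ?_
      have : 0 ≤ s * R₀ := by positivity
      linarith
    have h2 : (2 * Real.sqrt 2 / s + 2) ^ 2 ≤ 2 * (8 * (1 / s) ^ 2 + 4) := by
      have e : 2 * Real.sqrt 2 / s = 2 * Real.sqrt 2 * (1 / s) := by ring
      rw [e]
      have hs2 : Real.sqrt 2 ^ 2 = 2 := Real.sq_sqrt (by norm_num)
      nlinarith [sq_nonneg (2 * Real.sqrt 2 * (1 / s) - 2), Real.sqrt_nonneg 2]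
    have h3 : (1 / s + 1) ^ 2 ≤ 2 * ((1 / s) ^ 2 + 1) := by nlinarith [sq_nonneg (1 / s - 1)]
    rw [hB]; nlinarith
  have hkey : A ^ 2 * B ≤ 24 * π ^ 2 * A * D + 64 * A ^ 2 := by
    have := mul_le_mul_of_nonneg_left hBle (sq_nonneg A)
    rw [ht2] at this
    have e : A ^ 2 * (96 * (π ^ 2 * D / (4 * A)) + 64) = 24 * π ^ 2 * A * D + 64 * A ^ 2 := by
      field_simp; ring
    linarith [e.symm.le]
  calc Real.sqrt (4096 * B) * (4 * (L : ℝ) ^ 2) * (A / (L : ℝ) ^ 2) = 256 * (A * Real.sqrt B) := by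
        rw [Real.sqrt_mul (by norm_num), show (4096 : ℝ) = 64 ^ 2 by norm_num, Real.sqrt_sq (by norm_num)]
        field_simp
        ring
    _ = 256 * Real.sqrt (A ^ 2 * B) := by rw [Real.sqrt_mul (sq_nonneg A), Real.sqrt_sq hA.le]
    _ ≤ 256 * Real.sqrt (24 * π ^ 2 * A * D + 64 * A ^ 2) := by gcongr

end PosKernel

end Summit.HubbardSuperconductivity.HubbardSuperconductivity.Theorems.TorusFourierL2

end
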